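import Summits.Ventures.CertifiedQuantumChemistry.Hamiltonians.Tables
import HarnessLib

/-!
# Ventures/CertifiedQuantumChemistry — Hamiltonians/HAtomDef2svpHcore1e5oEri1.lean: two-electron table of `hAtomDef2svpHcore1e5o`, part 1/1

HONEST FRAMING (verbatim): certified bounds for a stated model Hamiltonian in a stated basis; not a
claim about the real molecule or material beyond that model.

Part 1 of 1 of the canonical two-electron integral table of the literal model `hAtomDef2svpHcore1e5o`
(head module `Hamiltonians/HAtomDef2svpHcore1e5o.lean`, which imports the parts, concatenates them and defines the
`Model 5`): entries 1–33 of the 33 non-zero canonical entries (sorted by key) of the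
integral file `chem-oracle/model/n2/schrock-MeN3N-print/H_atom_def2svp_hcore-eigenbasis_1e5o.clean.fcidump` (fcidump_sha256 `83a2c97923e4afd9dca50fff0dfba47825ef0132691b4c2f55171d75ee8811cb`), a file
PINNED in the LADDER-CHEM cell chem-oracle (see the head module for the MODEL PIN and its referee line).
The table is split over sibling modules only to respect the per-file line budget of the tree
(`k = 5` exceeds the single-file `k ≤ 10` class of pub-qchem ruling K3; ruling TYP-3 (e), inherited by
the chem-oracle cell). Same generator conventions as every `Hamiltonians/*.lean` literal model (reader A
exact decimals → rationals; keys = `quadKey` = reader A's `canon_eri_key`, asserted for all `k⁴` index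
tuples). Typed by chem-type-01 (cell chem-oracle, I-TYPE). Nothing is asserted here.
-/

namespace Summit.Ventures.CertifiedQuantumChemistry.Hamiltonians

/-- Two-electron integrals `(pq|rs)` of `hAtomDef2svpHcore1e5o`, canonical-key table chunk 1/1 (keys `((p,q),(r,s))`, 0-based; values = (numerator, denominator)). -/
def hAtomDef2svpHcore1e5o_eriTab1 : List (((ℕ × ℕ) × (ℕ × ℕ)) × (ℤ × ℕ)) := [
  (((0, 0), (0, 0)), (6252505789529417, 10000000000000000)), (((0, 0), (0, 1)), (-1817076889406433, 10000000000000000)), (((0, 0), (1, 1)), (5186218980718007, 10000000000000000)),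
  (((0, 0), (2, 2)), (3396085541183129, 5000000000000000)), (((0, 0), (3, 3)), (3396085541183129, 5000000000000000)), (((0, 0), (4, 4)), (3396085541183129, 5000000000000000)),
  (((0, 1), (0, 1)), (51272546032719, 400000000000000)), (((0, 1), (1, 1)), (-1437414589849639, 10000000000000000)), (((0, 1), (2, 2)), (-2039895886542661, 10000000000000000)),
  (((0, 1), (3, 3)), (-2039895886542661, 10000000000000000)), (((0, 1), (4, 4)), (-2039895886542661, 10000000000000000)), (((0, 2), (0, 2)), (1326361281365791, 10000000000000000)),
  (((0, 2), (1, 2)), (-1193052458677633, 20000000000000000)), (((0, 3), (0, 3)), (1326361281365791, 10000000000000000)), (((0, 3), (1, 3)), (-1193052458677633, 20000000000000000)),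
  (((0, 4), (0, 4)), (1326361281365791, 10000000000000000)), (((0, 4), (1, 4)), (-1193052458677633, 20000000000000000)), (((1, 1), (1, 1)), (460903238240541, 1000000000000000)),
  (((1, 1), (2, 2)), (1356095554497171, 2500000000000000)), (((1, 1), (3, 3)), (1356095554497171, 2500000000000000)), (((1, 1), (4, 4)), (1356095554497171, 2500000000000000)),
  (((1, 2), (1, 2)), (3711436686586901, 100000000000000000)), (((1, 3), (1, 3)), (3711436686586901, 100000000000000000)), (((1, 4), (1, 4)), (3711436686586901, 100000000000000000)),
  (((2, 2), (2, 2)), (4121116452632929, 5000000000000000)), (((2, 2), (3, 3)), (113015310882153, 156250000000000)), (((2, 2), (4, 4)), (113015310882153, 156250000000000)),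
  (((2, 3), (2, 3)), (5046265044040321, 100000000000000000)), (((2, 4), (2, 4)), (5046265044040321, 100000000000000000)), (((3, 3), (3, 3)), (4121116452632929, 5000000000000000)),
  (((3, 3), (4, 4)), (113015310882153, 156250000000000)), (((3, 4), (3, 4)), (5046265044040321, 100000000000000000)), (((4, 4), (4, 4)), (128784889144779, 156250000000000))
]

end Summit.Ventures.CertifiedQuantumChemistry.Hamiltonians
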